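import HarnessLib

/-!
# BSD rank-≤1 residual cell, class X11b @ 3 — the `GL₂(𝔽₃)` ARTIN-SPLIT CERTIFICATE (kernel-side finite check for the analytic road)

HONEST FRAMING (cell `b2b-bsdres-*`, verbatim): the cell deletes COMBINATION-SHAPED residual classes of the rank-≤1 BSD formula
from PUBLISHED theorems only and TYPES the construction-shaped remainder; this is not "finishing BSD". Class X11 ∧ r = 1 ∧ p = 3
stays CONSTRUCTION-SHAPED at class level (REFEREE R6.2, `X11/Typed.lean`). This file books NOTHING (no pair, count, mark or tier):
it is the finite-group layer of a DESK INSTRUMENT of the X11b@3 row — the ANALYTIC ROAD for the 838-class upper-bound-only TAIL of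
the lane's rank-one residue (unit `b2b-bsdres-x11b` GEN 13, `HOME/b2b-bsdres-x11b/X11B-AUDIT.md` §22, memo
`HOME/b2b-bsdres-x11b/g13/ANALYTIC-ROAD.md`), i.e. the x9 route-2 recipe (referee A R194.9 (a), `X9/ArtinSplit5S4Certificate.lean`)
transplanted from `5S4` to `GL₂(𝔽₃)`: the GRH-free 3-Selmer certificate of a tail class needs the class number of the 3-descent
octic `A = ℚ(T)` (`T ∈ E[3] ∖ 0`), and `ζ_A = ζ_{A⁺}·L(s, ψ₄)` puts its cost in ONE degree-4 Artin `L`-value of conductor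
`|d_A|/|d_{A⁺}| ≤ 2·10¹³` (all 838 classes) instead of Zimmert's bound `∝ √|d_A|` (`|d_A|` up to `10²⁶`). Referee A's R194.9 (a)(2)
asks for the finite-group identities of such a split "as a finite-group THEOREM … a kernel-side finite check"; here they are, each
evaluated by the KERNEL (`decide +kernel`; no `native_decide`). Generator + independent exact re-derivation of every table (pure
Python, explicit induced matrices, all `48²` products): `HOME/b2b-bsdres-x11b/g13/gl2f3_psi4.py` (output `gl2f3_psi4.out`).

## Objects (explicit, computable)
* `G = GL₂(𝔽₃)` (48 elements, column vectors of `𝔽₃² = E[3]`; every residue row has `im ρ̄_{E,3} = GL₂(𝔽₃)`), `T = e₁`,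
  `H = Stab_G(e₁)` (order 6; fixed field = the octic `A = ℚ(T)` of the descent), `B = Stab_G⟨e₁⟩` = the upper-triangular Borel
  (order 12; fixed field = the quartic `A⁺ = ℚ(x(T))` = the 3-division-polynomial field), `χ : B → {±1}`, `χ([[a,b],[0,d]]) = (a/3)`
  (Legendre symbol), kernel `H`, so `A = A⁺(√·)` is the quadratic extension cut out by `χ`.
* `π₈ = 1_H^G` (permutation character on the 8 non-zero vectors), `π₄ = 1_B^G` (on the 4 lines), **`ψ₄ := π₈ − π₄`**.
* `S_B(g) := Σ_{x ∈ G, x⁻¹gx ∈ B} χ(x⁻¹gx) = |B|·χ(Ind_B^G χ)(g)` (Frobenius, Serre §7.2 Prop. 20).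

## Certified statements (§3)
1. `card_G`, `subgroups`: `|G| = 48`; `H`, `B` are the stabilisers, closed under products, `|H| = 6`, `|B| = 12`, `H ⊆ B`, `−1 ∈ B ∖ H`;
   `χ` is multiplicative on `B` with kernel `H`.
2. `ind_chi_identity`: **`S_B = 12·ψ₄` on `G`**, i.e. `χ(Ind_B^G χ) = π₈ − π₄ = ψ₄`; with `1_H^G = π₈`, `1_B^G = π₄` this is
   `1_H^G = 1_B^G + Ind_B^G χ`, hence (Artin formalism; characters determine representations, Serre §2.3)
   `ζ_A(s) = ζ_{A⁺}(s)·L(s, Ind_B^G χ) = ζ_{A⁺}(s)·L(s, χ_{A/A⁺})` — the `L`-function of `ψ₄` IS the Hecke `L`-function of the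
   quadratic character of `A⁺` cutting out `A` (entire with functional equation: Hecke; cited on paper, not here).
3. `psi4_irreducible`: `Σ_g ψ₄(g)² = 48` (`⟨ψ₄,ψ₄⟩ = 1`) and `Σ_g ψ₄(g²) = 48` (Frobenius–Schur indicator `+1`: `ψ₄` is orthogonal).
4. `class_separation`: every `g ∈ G` is conjugate in `G` to `classRep (tr g) (det g) (fixedLines g)`; the 8 classes are thus SEPARATED by
   `(tr, det, #fixed lines)` = `(a_p(E) mod 3, p mod 3, #roots of the 3-division polynomial mod p)` at a good prime `p ∤ 3N` (recipe A of
   the certificate); `(tr, det)` alone does NOT separate (`1` vs a transvection; `−1` vs `−`transvection).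
5. `euler_table`: on each class the power sums `ψ₄(g), ψ₄(g²), ψ₄(g³), ψ₄(g⁴)` and, by Newton's identities (exact integer divisions,
   checked), the coefficients of `det(1 − ψ₄(g)X)`: `1:(1−X)⁴`, `−1:(1+X)⁴`, involution `(1−X²)²`, transvection `(1−X)(1−X³)`,
   `−`transvection `(1+X)(1+X³)`, order 4 `(1+X²)²`, order 8 `1+X⁴` — the good-prime Euler factors of `L(s, ψ₄)` by class.
6. `conj_class`: the class with `det = −1` and `g² = 1` (complex conjugation) has `ψ₄ = 0`, Euler polynomial `(1−X²)²` (eigenvalues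
   `+1,+1,−1,−1`: `Γ`-factor `Γ_ℝ(s)²Γ_ℝ(s+1)²`), fixes 2 vectors (`r₁(A) = 2`) and 2 lines (`r₁(A⁺) = 2`).
7. `inertia_invariants`: `dim ψ₄^U = 2` for `U` generated by a transvection (tame multiplicative `q ≠ 3`: conductor exponent 2), `= 1` for
   the `S₃ ≅ H` containing it, `= 0` for `⟨−1⟩` (any inertia containing `−1` kills `ψ₄`).
NOT here (on paper / in the records): `Gal(ℚ(E[3])/ℚ) ≅ GL₂(𝔽₃)` per curve, class field theory, Artin formalism, Hecke's analytic
continuation, ramified Euler factors (taken from the field data in the records), every numerical value.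
References: J.-P. Serre, *Linear representations of finite groups* §2.3, §7.2; E. Hecke, Math. Z. 6 (1920) 11–51.
-/

set_option autoImplicit false

namespace Summit.BirchSwinnertonDyer.Rank1Residual.X11b.ArtinSplitGL2F3

/-! ## §1 Carriers: `2×2` matrices and vectors over `𝔽₃` -/
/-- A `2×2` matrix `[[a,b],[c,d]]` with natural-number entries READ MODULO 3 (every operation reduces mod 3). -/
structure M2 where
  (a b c d : Nat)
deriving DecidableEq

namespace M2
/-- product over `𝔽₃` -/
def mul (x y : M2) : M2 :=
  ⟨(x.a * y.a + x.b * y.c) % 3, (x.a * y.b + x.b * y.d) % 3, (x.c * y.a + x.d * y.c) % 3, (x.c * y.b + x.d * y.d) % 3⟩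
/-- identity -/
def one : M2 := ⟨1, 0, 0, 1⟩
/-- `−1` -/
def negOne : M2 := ⟨2, 0, 0, 2⟩
/-- trace mod 3 -/
def tr (x : M2) : Nat := (x.a + x.d) % 3
/-- determinant mod 3 (`−bc ≡ 2bc`) -/
def det (x : M2) : Nat := (x.a * x.d + 2 * (x.b * x.c)) % 3
/-- inverse over `𝔽₃` (adjugate · `det⁻¹`, and `det⁻¹ = det` in `𝔽₃^×`; junk when `det = 0`) -/
def inv (x : M2) : M2 :=
  ⟨(x.d * det x) % 3, (2 * x.b * det x) % 3, (2 * x.c * det x) % 3, (x.a * det x) % 3⟩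
/-- `x⁻¹ g x` -/
def conjBy (x g : M2) : M2 := mul (mul (inv x) g) x
/-- all 81 matrices with entries `< 3` -/
def all : List M2 :=
  (List.range 3).flatMap fun a => (List.range 3).flatMap fun b => (List.range 3).flatMap fun c =>
    (List.range 3).map fun d => (⟨a, b, c, d⟩ : M2)
end M2

/-- a column vector `(u, v)` of `𝔽₃²` (read mod 3) -/
structure V2 where
  (u v : Nat)
deriving DecidableEq

namespace V2
/-- `g · w` -/
def act (g : M2) (w : V2) : V2 := ⟨(g.a * w.u + g.b * w.v) % 3, (g.c * w.u + g.d * w.v) % 3⟩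
/-- `−w` -/
def neg (w : V2) : V2 := ⟨(2 * w.u) % 3, (2 * w.v) % 3⟩
/-- the 8 non-zero vectors (`= E[3] ∖ 0`) -/
def nonzero : List V2 := [⟨0, 1⟩, ⟨0, 2⟩, ⟨1, 0⟩, ⟨1, 1⟩, ⟨1, 2⟩, ⟨2, 0⟩, ⟨2, 1⟩, ⟨2, 2⟩]
/-- one representative per line (`= ℙ¹(𝔽₃)`, the 4 subgroups of order 3 of `E[3]`) -/
def lineReps : List V2 := [⟨0, 1⟩, ⟨1, 0⟩, ⟨1, 1⟩, ⟨1, 2⟩]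
end V2

/-! ## §2 The group, the two stabilisers, the character `χ`, `ψ₄`, the Frobenius sum, class data -/
/-- **`G = GL₂(𝔽₃)`** -/
def Glist : List M2 := M2.all.filter fun m => m.det != 0
/-- **`H = Stab_G(e₁)`**: `g e₁ = e₁`, i.e. `a = 1, c = 0` -/
def Hlist : List M2 := Glist.filter fun g => V2.act g ⟨1, 0⟩ == ⟨1, 0⟩
/-- **`B = Stab_G⟨e₁⟩`** (the Borel subgroup): `g e₁ ∈ {e₁, −e₁}`, i.e. `c = 0` -/
def Blist : List M2 := Glist.filter fun g => V2.act g ⟨1, 0⟩ == ⟨1, 0⟩ || V2.act g ⟨1, 0⟩ == ⟨2, 0⟩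
/-- `χ : B → {±1}`, `χ([[a,b],[0,d]]) = (a/3)` as an integer (junk off `B`) -/
def chi (g : M2) : Int := if g.a % 3 == 1 then 1 else -1
/-- number of non-zero vectors fixed by `g` (`= π₈(g) = 1_H^G(g)`) -/
def fixedVecs (g : M2) : Nat := (V2.nonzero.filter fun w => V2.act g w == w).length
/-- number of lines fixed by `g` (`= π₄(g) = 1_B^G(g)`): `g w ∈ {w, −w}` -/
def fixedLines (g : M2) : Nat := (V2.lineReps.filter fun w => V2.act g w == w || V2.act g w == V2.neg w).length
/-- **`ψ₄ := π₈ − π₄`** -/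
def psi4 (g : M2) : Int := (fixedVecs g : Int) - (fixedLines g : Int)
/-- **`S_B(g) = Σ_{x ∈ G, x⁻¹gx ∈ B} χ(x⁻¹gx)`** (`= 12·χ(Ind_B^G χ)(g)`, Serre §7.2 Prop. 20) -/
def S_B (g : M2) : Int :=
  Glist.foldl (fun acc x => if Blist.contains (M2.conjBy x g) then acc + chi (M2.conjBy x g) else acc) 0
/-- `g^n` -/
def pow (g : M2) : Nat → M2
  | 0 => M2.one
  | n + 1 => M2.mul (pow g n) g
/-- element order (`≤ 8` on `G`; junk `0` otherwise) -/
def order (g : M2) : Nat :=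
  match (List.range 9).find? fun n => n != 0 && pow g n == M2.one with
  | some n => n | none => 0
/-- a representative for each value of `(tr, det, #fixed lines)` occurring in `G` (8 classes; junk `1` elsewhere):
`(2,1,4) ↦ 1`, `(1,1,4) ↦ −1`, `(0,2,2) ↦` involution, `(2,1,1) ↦` transvection, `(1,1,1) ↦ −`transvection,
`(0,1,0) ↦` order 4, `(1,2,0)`, `(2,2,0) ↦` order 8. -/
def classRep (t dd fl : Nat) : M2 :=
  match t, dd, fl with
  | 2, 1, 4 => ⟨1, 0, 0, 1⟩ | 1, 1, 4 => ⟨2, 0, 0, 2⟩ | 0, 2, 2 => ⟨0, 1, 1, 0⟩ | 2, 1, 1 => ⟨0, 1, 2, 2⟩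
  | 1, 1, 1 => ⟨0, 1, 2, 1⟩ | 0, 1, 0 => ⟨0, 1, 2, 0⟩ | 1, 2, 0 => ⟨0, 1, 1, 1⟩ | 2, 2, 0 => ⟨0, 1, 1, 2⟩
  | _, _, _ => M2.one
/-- the 8 class representatives as a list -/
def classReps : List M2 := [⟨1, 0, 0, 1⟩, ⟨2, 0, 0, 2⟩, ⟨0, 1, 1, 0⟩, ⟨0, 1, 2, 2⟩, ⟨0, 1, 2, 1⟩, ⟨0, 1, 2, 0⟩, ⟨0, 1, 1, 1⟩, ⟨0, 1, 1, 2⟩]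
/-- power sums `p_k = ψ₄(g^k)`, `k = 1..4` -/
def powerSums (g : M2) : List Int := [psi4 (pow g 1), psi4 (pow g 2), psi4 (pow g 3), psi4 (pow g 4)]
/-- coefficients `[c₀, c₁, c₂, c₃, c₄]` of `det(1 − M X) = 1 − e₁X + e₂X² − e₃X³ + e₄X⁴` from the power sums of the 4 eigenvalues by
Newton's identities (`e₁ = p₁`, `2e₂ = e₁p₁ − p₂`, `3e₃ = e₂p₁ − e₁p₂ + p₃`, `4e₄ = e₃p₁ − e₂p₂ + e₁p₃ − p₄`; integer divisions, exactness
is part of `euler_table`). -/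
def eulerCoeffs (g : M2) : List Int :=
  let p1 := psi4 (pow g 1); let p2 := psi4 (pow g 2); let p3 := psi4 (pow g 3); let p4 := psi4 (pow g 4)
  let e1 := p1
  let e2 := (e1 * p1 - p2) / 2
  let e3 := (e2 * p1 - e1 * p2 + p3) / 3
  let e4 := (e3 * p1 - e2 * p2 + e1 * p3 - p4) / 4
  [1, -e1, e2, -e3, e4]
/-- the Newton divisions are exact -/
def newtonExact (g : M2) : Bool :=
  let p1 := psi4 (pow g 1); let p2 := psi4 (pow g 2); let p3 := psi4 (pow g 3); let p4 := psi4 (pow g 4)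
  let e1 := p1
  let e2 := (e1 * p1 - p2) / 2
  let e3 := (e2 * p1 - e1 * p2 + p3) / 3
  ((e1 * p1 - p2) % 2 == 0) && ((e2 * p1 - e1 * p2 + p3) % 3 == 0) && ((e3 * p1 - e2 * p2 + e1 * p3 - p4) % 4 == 0)
/-- **the Euler polynomial of `ψ₄` by class key `(tr, det, #fixed lines)`** (coefficient lists; junk `[]` elsewhere) -/
def eulerTable (t dd fl : Nat) : List Int :=
  match t, dd, fl with
  | 2, 1, 4 => [1, -4, 6, -4, 1]   -- 1:            (1 − X)⁴
  | 1, 1, 4 => [1, 4, 6, 4, 1]     -- −1:           (1 + X)⁴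
  | 0, 2, 2 => [1, 0, -2, 0, 1]    -- involution:   (1 − X²)²
  | 2, 1, 1 => [1, -1, 0, -1, 1]   -- transvection: (1 − X)(1 − X³)
  | 1, 1, 1 => [1, 1, 0, 1, 1]     -- −transvection:(1 + X)(1 + X³)
  | 0, 1, 0 => [1, 0, 2, 0, 1]     -- order 4:      (1 + X²)²
  | 1, 2, 0 => [1, 0, 0, 0, 1]     -- order 8:      1 + X⁴
  | 2, 2, 0 => [1, 0, 0, 0, 1]     -- order 8:      1 + X⁴
  | _, _, _ => []
/-- the cyclic subgroup `⟨g⟩ = {g⁰, …, g^{order g − 1}}` as a list -/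
def cyclic (g : M2) : List M2 := (List.range (order g)).map fun n => pow g n
/-- `|U|·dim ψ₄^U = Σ_{u ∈ U} ψ₄(u)` for a list `U` (with repetitions as listed) -/
def sumPsi (U : List M2) : Int := U.foldl (fun acc u => acc + psi4 u) 0

/-! ## §3 The theorems — each evaluated by the Lean kernel (`decide +kernel`) -/

/-- `|G| = 48`, no repetitions; `1, −1 ∈ G`; `G` is closed under products and `inv` is the inverse on `G`. -/
theorem card_G :
    Glist.length = 48 ∧ Glist.Nodup ∧ M2.one ∈ Glist ∧ M2.negOne ∈ Glist ∧
    (∀ x ∈ Glist, ∀ y ∈ Glist, M2.mul x y ∈ Glist) ∧ (∀ x ∈ Glist, M2.mul x (M2.inv x) = M2.one ∧ M2.mul (M2.inv x) x = M2.one) := by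
  decide +kernel

/-- **Stabilisers and `χ`**: `|H| = 6`, `|B| = 12`, `H ⊆ B ⊆ G`, both closed under products; `H = {a = 1, c = 0}`, `B = {c = 0}`;
`−1 ∈ B`, `−1 ∉ H`; `H` is non-abelian (`≅ S₃`); `χ` is multiplicative on `B`, takes the value `−1` on `B`, and `ker χ = H`. -/
theorem subgroups :
    Hlist.length = 6 ∧ Blist.length = 12 ∧ (∀ h ∈ Hlist, h ∈ Blist) ∧ (∀ b ∈ Blist, b ∈ Glist) ∧
    (∀ x ∈ Hlist, ∀ y ∈ Hlist, M2.mul x y ∈ Hlist) ∧ (∀ x ∈ Blist, ∀ y ∈ Blist, M2.mul x y ∈ Blist) ∧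
    (∀ g ∈ Glist, (g ∈ Hlist ↔ (g.a = 1 ∧ g.c = 0))) ∧ (∀ g ∈ Glist, (g ∈ Blist ↔ g.c = 0)) ∧
    M2.negOne ∈ Blist ∧ M2.negOne ∉ Hlist ∧ (∃ x ∈ Hlist, ∃ y ∈ Hlist, M2.mul x y ≠ M2.mul y x) ∧
    (∀ x ∈ Blist, ∀ y ∈ Blist, chi (M2.mul x y) = chi x * chi y) ∧ chi M2.negOne = -1 ∧
    (∀ b ∈ Blist, (chi b = 1 ↔ b ∈ Hlist)) := by
  decide +kernel

/-- `π₈ = 1_H^G` and `π₄ = 1_B^G` are the permutation characters of TRANSITIVE actions with these stabilisers: `G·e₁` = all 8 non-zero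
vectors, `G·⟨e₁⟩` = all 4 lines; `Σ_g π₈(g) = Σ_g π₄(g) = |G|` (one orbit each, Burnside). -/
theorem transitive :
    (∀ w ∈ V2.nonzero, ∃ g ∈ Glist, V2.act g ⟨1, 0⟩ = w) ∧
    (∀ w ∈ V2.lineReps, ∃ g ∈ Glist, V2.act g ⟨1, 0⟩ = w) ∧
    (Glist.foldl (fun acc g => acc + (fixedVecs g : Int)) 0 = 48) ∧ (Glist.foldl (fun acc g => acc + (fixedLines g : Int)) 0 = 48) := by
  decide +kernel

/-- **Identity: `χ(Ind_B^G χ) = π₈ − π₄ = ψ₄`** on `G`, in the integral form `S_B = 12·ψ₄` (`S_B = |B|·χ(Ind_B^G χ)`, Serre §7.2).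
Hence `1_H^G = 1_B^G + Ind_B^G χ` and, by Artin formalism, `ζ_A = ζ_{A⁺}·L(s, χ_{A/A⁺})`. -/
theorem ind_chi_identity : ∀ g ∈ Glist, S_B g = 12 * psi4 g := by
  decide +kernel

/-- **`ψ₄` is irreducible and orthogonal**: `Σ_{g∈G} ψ₄(g)² = |G|` (`⟨ψ₄,ψ₄⟩ = 1`; `ψ₄` is real so `ψ₄(g⁻¹) = ψ₄(g)`) and
`Σ_{g∈G} ψ₄(g²) = |G|` (Frobenius–Schur indicator `+1`); values: `ψ₄(1) = 4`, `ψ₄(−1) = −4`. -/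
theorem psi4_irreducible :
    (Glist.foldl (fun acc g => acc + psi4 g * psi4 g) 0 = 48) ∧ (∀ g ∈ Glist, psi4 (M2.inv g) = psi4 g) ∧
    (Glist.foldl (fun acc g => acc + psi4 (M2.mul g g)) 0 = 48) ∧ psi4 M2.one = 4 ∧ psi4 M2.negOne = -4 := by
  decide +kernel

/-- **Class separation by `(tr, det, #fixed lines)`**: every `g ∈ G` is `G`-conjugate to `classRep (tr g) (det g) (fixedLines g)`, which
lies in `G`, is one of the 8 listed representatives, and has the same key; the 8 representatives have pairwise distinct keys and are
pairwise NON-conjugate. So the class of `ρ̄(Frob_p)` is read off `(a_p(E) mod 3, p mod 3, #𝔽_p-roots of the 3-division polynomial)`.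
`(tr, det)` alone fails exactly twice: `1` vs the transvection `(2,1,·)`, `−1` vs `−`transvection `(1,1,·)`. -/
theorem class_separation :
    (∀ g ∈ Glist, classRep g.tr g.det (fixedLines g) ∈ classReps ∧ (classRep g.tr g.det (fixedLines g)).tr = g.tr ∧
      (classRep g.tr g.det (fixedLines g)).det = g.det ∧ fixedLines (classRep g.tr g.det (fixedLines g)) = fixedLines g ∧
      ∃ x ∈ Glist, M2.conjBy x g = classRep g.tr g.det (fixedLines g)) ∧
    (∀ r ∈ classReps, r ∈ Glist) ∧ classReps.length = 8 ∧
    (∀ r ∈ classReps, ∀ s ∈ classReps, r ≠ s → ((r.tr, r.det, fixedLines r) ≠ (s.tr, s.det, fixedLines s) ∧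
      ∀ x ∈ Glist, M2.conjBy x r ≠ s)) ∧
    ((⟨1, 0, 0, 1⟩ : M2).tr = (⟨0, 1, 2, 2⟩ : M2).tr ∧ (⟨1, 0, 0, 1⟩ : M2).det = (⟨0, 1, 2, 2⟩ : M2).det) ∧
    ((⟨2, 0, 0, 2⟩ : M2).tr = (⟨0, 1, 2, 1⟩ : M2).tr ∧ (⟨2, 0, 0, 2⟩ : M2).det = (⟨0, 1, 2, 1⟩ : M2).det) := by
  decide +kernel

/-- class data of the 8 representatives: `(order, class size, #fixed vectors, #fixed lines, ψ₄)` =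
`1:(1,1,8,4,4)`, `−1:(2,1,0,4,−4)`, involution `(2,12,2,2,0)`, transvection `(3,8,2,1,1)`, `−`transvection `(6,8,0,1,−1)`,
order 4 `(4,6,0,0,0)`, order 8 `(8,6,0,0,0)` twice. -/
theorem class_data :
    (classReps.map fun r => (order r, (Glist.filter fun g => Glist.any fun x => M2.conjBy x g == r).length, fixedVecs r, fixedLines r, psi4 r)) =
      [(1, 1, 8, 4, 4), (2, 1, 0, 4, -4), (2, 12, 2, 2, 0), (3, 8, 2, 1, 1), (6, 8, 0, 1, -1), (4, 6, 0, 0, 0), (8, 6, 0, 0, 0), (8, 6, 0, 0, 0)] := by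
  decide +kernel

/-- **Euler table**: for every `g ∈ G` the Newton divisions are exact and the resulting coefficients of `det(1 − ψ₄(g)X)` (from the
power sums `ψ₄(g^k)`, `k ≤ 4`, of the 4 eigenvalues — roots of unity since `g²⁴ = 1`, checked) equal `eulerTable` at the
key `(tr g, det g, #fixed lines)`; i.e. the good-prime local factor of `L(s, ψ₄)` at `p` with `ρ̄(Frob_p) ∼ g` is as tabulated:
`(1−X)⁴, (1+X)⁴, (1−X²)², (1−X)(1−X³), (1+X)(1+X³), (1+X²)², 1+X⁴`. -/
theorem euler_table :
    ∀ g ∈ Glist, newtonExact g = true ∧ eulerCoeffs g = eulerTable g.tr g.det (fixedLines g) ∧ pow g 24 = M2.one := by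
  decide +kernel

/-- **Complex-conjugation class** = the involutions of determinant `−1` (`det = 2`): non-empty; on it `ψ₄ = 0`, the Euler polynomial is
`(1 − X²)²` (eigenvalues `+1,+1,−1,−1`, so the `Γ`-factor of `L(s,ψ₄)` is `Γ_ℝ(s)²Γ_ℝ(s+1)²`), `#fixed vectors = 2` (`r₁(A) = 2`,
`r₂(A) = 3`) and `#fixed lines = 2` (`r₁(A⁺) = 2`, `r₂(A⁺) = 1`). -/
theorem conj_class :
    (∃ g ∈ Glist, g.det = 2 ∧ M2.mul g g = M2.one) ∧
    ∀ g ∈ Glist, (g.det = 2 ∧ M2.mul g g = M2.one) →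
      (psi4 g = 0 ∧ eulerCoeffs g = [1, 0, -2, 0, 1] ∧ fixedVecs g = 2 ∧ fixedLines g = 2) := by
  decide +kernel

/-- **Inertia invariants** (`Σ_{u ∈ U} ψ₄(u) = |U|·dim ψ₄^U`): for a transvection `g` (order 3; tame inertia at a multiplicative
`q ≠ 3` with `3 ∤ v_q(Δ)`): `Σ_{⟨g⟩} ψ₄ = 6 = 3·2` (invariants of dimension 2 ⇒ conductor exponent `4 − 2 = 2`, local factor of degree 2);
for `H ≅ S₃` (a transvection and an involution; the tame-by-wild shape at `3`): `Σ_H ψ₄ = 6 = 6·1` (dimension 1); for `⟨−1⟩`, for `B`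
and for `G`: `0` (no invariants — in particular any inertia group containing `−1` kills `ψ₄`). -/
theorem inertia_invariants :
    (∀ g ∈ Glist, order g = 3 → ((cyclic g).length = 3 ∧ sumPsi (cyclic g) = 6)) ∧
    sumPsi Hlist = 6 ∧ sumPsi [M2.one, M2.negOne] = 0 ∧ sumPsi Blist = 0 ∧ sumPsi Glist = 0 := by
  decide +kernel

end Summit.BirchSwinnertonDyer.Rank1Residual.X11b.ArtinSplitGL2F3
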